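import Mathlib
import Summits.AnomalousDissipation.AnomalousDissipation.Theorems.SoloBlindShearedCover

/-!
# SoloBlind — sheared boxes cover the straight strip, Euclidean radius (ENGINE L v0.4, ENGINE-L-SPEC §10; kernel #260)

Kernel #259 (`SoloBlindShearedCover`) bounds the distance of a strip point `x` from the sheared disc
centre `s · (a + i y₀)` by the `ℓ¹`-type quantity `s_hi · hx/2 + hy/2 + |y₀| · max (s_hi - 1) (1 - s_lo)`.
The production tiling of band X3 uses sheared discs of radius `r = 0.2`, which the `ℓ¹` bound
(`≈ 0.26`) does not certify but the EUCLIDEAN bound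
`√((s_hi · hx/2)² + (hy/2 + |y₀| · max (s_hi - 1) (1 - s_lo))²) ≈ 0.1875` does.  This file proves the
Euclidean form: the real and imaginary deviations are bounded separately exactly as in #259 and then
combined through `‖z‖² = (Re z)² + (Im z)²`.
-/

namespace Summit.AnomalousDissipation.SoloBlind.ShearedCoverEuclid

/-- Componentwise deviations of a strip point from the sheared centre (as in kernel #259). -/
theorem re_im_dev {x : ℂ} {a y₀ s slo shi hx hy : ℝ} (hs : slo ≤ s ∧ s ≤ shi) (hslo : 0 < slo)
    (hhx : 0 ≤ hx) (hre : |x.re / s - a| ≤ hx / 2) (him : |x.im - y₀| ≤ hy / 2) :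
    |(x - (s : ℂ) * ((a : ℂ) + (y₀ : ℂ) * Complex.I)).re| ≤ shi * (hx / 2) ∧
    |(x - (s : ℂ) * ((a : ℂ) + (y₀ : ℂ) * Complex.I)).im| ≤ hy / 2 + |y₀| * max (shi - 1) (1 - slo) := by
  have hs0 : 0 < s := lt_of_lt_of_le hslo hs.1
  set z : ℂ := x - (s : ℂ) * ((a : ℂ) + (y₀ : ℂ) * Complex.I) with hz
  have hzre : z.re = s * (x.re / s - a) := by
    rw [hz]; simp; field_simp
  have hzim : z.im = (x.im - y₀) + y₀ * (1 - s) := by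
    rw [hz]; simp; ring
  refine ⟨?_, ?_⟩
  · rw [hzre, abs_mul, abs_of_pos hs0]
    calc s * |x.re / s - a| ≤ s * (hx / 2) := mul_le_mul_of_nonneg_left hre hs0.le
      _ ≤ shi * (hx / 2) := mul_le_mul_of_nonneg_right hs.2 (by linarith)
  · rw [hzim]
    calc |x.im - y₀ + y₀ * (1 - s)| ≤ |x.im - y₀| + |y₀ * (1 - s)| := abs_add_le _ _
      _ = |x.im - y₀| + |y₀| * |1 - s| := by rw [abs_mul]
      _ ≤ hy / 2 + |y₀| * max (shi - 1) (1 - slo) :=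
          add_le_add him (mul_le_mul_of_nonneg_left (ShearedCover.abs_one_sub_le hs) (abs_nonneg _))

/-- Elementary: `|u| ≤ A`, `|v| ≤ B` ⇒ `√(u² + v²) ≤ √(A² + B²)`, phrased for a complex number
through `‖z‖ ^ 2 = z.re ^ 2 + z.im ^ 2`. -/
theorem norm_le_sqrt_of_abs_re_im {z : ℂ} {A B : ℝ} (h1 : |z.re| ≤ A) (h2 : |z.im| ≤ B) :
    ‖z‖ ≤ Real.sqrt (A ^ 2 + B ^ 2) := by
  have hA : 0 ≤ A := le_trans (abs_nonneg _) h1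
  have hB : 0 ≤ B := le_trans (abs_nonneg _) h2
  have e1 : z.re ^ 2 ≤ A ^ 2 := by
    have := pow_le_pow_left₀ (abs_nonneg _) h1 2
    simpa [sq_abs] using this
  have e2 : z.im ^ 2 ≤ B ^ 2 := by
    have := pow_le_pow_left₀ (abs_nonneg _) h2 2
    simpa [sq_abs] using this
  have hsq : ‖z‖ ^ 2 ≤ A ^ 2 + B ^ 2 := by
    rw [← Complex.normSq_eq_norm_sq, Complex.normSq_apply]
    nlinarith [e1, e2]
  calc ‖z‖ = Real.sqrt (‖z‖ ^ 2) := by rw [Real.sqrt_sq (norm_nonneg _)]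
    _ ≤ Real.sqrt (A ^ 2 + B ^ 2) := Real.sqrt_le_sqrt hsq

/-- SHEARED COVER, EUCLIDEAN RADIUS.  A point of the straight strip whose `g`-scaled real part lies
in the column of half-width `hx/2` around `a` and whose imaginary part lies in the row of half-width
`hy/2` around `y₀` belongs to the sheared disc about `s · (a + i y₀)` of radius
`√((s_hi hx/2)² + (hy/2 + |y₀| max (s_hi - 1) (1 - s_lo))²)`. -/
theorem sheared_cover_euclid {x : ℂ} {a y₀ s slo shi hx hy : ℝ} (hs : slo ≤ s ∧ s ≤ shi)
    (hslo : 0 < slo) (hhx : 0 ≤ hx) (hre : |x.re / s - a| ≤ hx / 2) (him : |x.im - y₀| ≤ hy / 2) :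
    ‖x - (s : ℂ) * ((a : ℂ) + (y₀ : ℂ) * Complex.I)‖
      ≤ Real.sqrt ((shi * (hx / 2)) ^ 2 + (hy / 2 + |y₀| * max (shi - 1) (1 - slo)) ^ 2) := by
  obtain ⟨h1, h2⟩ := re_im_dev hs hslo hhx hre him
  exact norm_le_sqrt_of_abs_re_im h1 h2

/-- The same statement with the centre written as the scaled complex point `s · x₀`. -/
theorem sheared_cover_euclid' {x x₀ : ℂ} {s slo shi hx hy : ℝ} (hs : slo ≤ s ∧ s ≤ shi)
    (hslo : 0 < slo) (hhx : 0 ≤ hx) (hre : |x.re / s - x₀.re| ≤ hx / 2)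
    (him : |x.im - x₀.im| ≤ hy / 2) :
    ‖x - (s : ℂ) * x₀‖
      ≤ Real.sqrt ((shi * (hx / 2)) ^ 2 + (hy / 2 + |x₀.im| * max (shi - 1) (1 - slo)) ^ 2) := by
  have h := sheared_cover_euclid (x := x) (a := x₀.re) (y₀ := x₀.im) hs hslo hhx hre him
  have hx0 : ((x₀.re : ℂ) + (x₀.im : ℂ) * Complex.I) = x₀ := Complex.re_add_im x₀
  rw [hx0] at h
  exact h

/-- Any radius at least the Euclidean bound also covers (the driver uses `r = 0.2 ≥ 0.1875` on X3). -/
theorem sheared_cover_of_le {x x₀ : ℂ} {s slo shi hx hy r : ℝ} (hs : slo ≤ s ∧ s ≤ shi)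
    (hslo : 0 < slo) (hhx : 0 ≤ hx) (hre : |x.re / s - x₀.re| ≤ hx / 2)
    (him : |x.im - x₀.im| ≤ hy / 2)
    (hr : Real.sqrt ((shi * (hx / 2)) ^ 2 + (hy / 2 + |x₀.im| * max (shi - 1) (1 - slo)) ^ 2) ≤ r) :
    ‖x - (s : ℂ) * x₀‖ ≤ r :=
  le_trans (sheared_cover_euclid' hs hslo hhx hre him) hr

end Summit.AnomalousDissipation.SoloBlind.ShearedCoverEuclid
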